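import Summits.Ventures.LatticeQCDFlow.Exactness.IMHCertificateCalibration
import HarnessLib

/-!
# Defensive mixing with the prior makes the exact flow sampler certifiable from its own proposals: with proposal density
# `(1 − ε)g + ε` against the prior and a target density `p ≤ P`, the weight is bounded by `P/ε` pointwise, both weight tails VANISH,
# and the every-weight Bernstein bar holds with no oracle input beyond `P`

HONEST FRAMING: exact (Metropolis-corrected) sampling algorithms for lattice gauge theory;
figures of merit are autocorrelation/cost numbers at stated couplings and volumes; no
continuum-physics claim.

Venture `LatticeQCDFlow` (cell pub-lqcd), topic `Exactness`; FANOUT row 30 (lean-1, GEN-41).  NEW WORK of the cell, general measurable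
state space with a PRIOR probability measure `λ` (Haar measure on the gauge group's product in the application).  GEN-41's
`HiddenSectorNoCertificate{,Inputs}` show that a flow which may propose a sector with tiny probability cannot be certified from its own
samples; `IMHCertificateCalibration` ∕ `IMHNormaliserBracketFromTwoSamples` supply the missing number from target samples.  Here is the
other repair, a design rule with a theorem: mix the flow with the prior.  Densities against `λ`: the flow `g ≥ 0` (`∫ g dλ = 1`), the
target `0 < p ≤ P` (`∫ p dλ = 1`; for the Wilson action `P = e^{−S_min}/Z̃` with `Z̃` certifiable from below by GEN-41's
`integral_min_unnormalised_le_normaliser`), the defensive proposal `g_ε = (1 − ε)g + ε` (`0 < ε ≤ 1`), its law `q_ε = g_ε·λ`, and the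
sampler's weight `w_ε = p/g_ε` — a pointwise function, the one the accept step evaluates.

* §1 `defensiveDensity_pos`, **`defensiveWeight_le`** — `0 < g_ε` and `0 < w_ε ≤ P/ε` POINTWISE; `defensiveWeight_measurable`;
  `setOf_lt_defensiveWeight_eq_empty` — `{y | P/ε < w_ε y} = ∅`: BOTH weight tails of the every-weight bars vanish at the level `M = P/ε`.
* §2 `lintegral_defensiveDensity`, **`isProbabilityMeasure_defensive`** — `q_ε` is a probability law; **`defensive_target_eq`** —
  `w_ε·q_ε = p·λ = π` (the sampler with proposal `q_ε` and weight `w_ε` targets `π` exactly); `isProbabilityMeasure_defensive_target`.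
* §3 **`lintegral_min_one_ge_of_weight_le`** — `c₁ = E_{q_ε}[min(1, w_ε)] ≥ 1/max(1, P/ε)` (no oracle: `min(1, w) ≥ w/max(1, P/ε)` and `E_{q_ε} w_ε = 1`).
* §4 **`crnLag_replicas_burnIn_bernstein_abs_target_defensive`** — THE CERTIFICATE WITH NO ORACLE INPUT BEYOND `P`: for the exact sampler
  with proposal `q_ε` and weight `w_ε`, from ANY start `x`, `R ≥ 1` independent coupled pairs, window `N`, burn-in `k`, `σ² ≥ Var_{δ_xK^k} f > 0`,
  `ε' ≥ 0`, `M⋆ = max(1, P/ε)`:  `P(|H̄_R − π f| ≥ ε' + (c − a)(1 − 1/M⋆²)^k) ≤ 2·exp(−Rε'²/(2(σ² + (c − a)ε'/3))) + R·(1 − 1/M⋆²)^k`.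
Reading (gauge files): spending a fraction `ε` of the proposals on the Haar prior buys a certificate computable before the run: the bias and coupling terms decay like `(1 − ε²/P²)^k` with `P = e^{−S_min}/Z̃` — finite and
honest, and exponential in the lattice volume (the volume barrier returns as the SIZE of the certificate, consistent with `Scaling/Barriers`).
NOT CLAIMED: the sharper rate `1 − ε/P` of the bounded-weight theory (GEN-35–39 need an attained maximum of the weight; the pointwise
`w_ε` need not attain `P/ε`); any claim that the certified `k` is affordable.  No `sorry`, no new definitions, nothing cited as a fact.
-/

noncomputable section

namespace Summit.Ventures.LatticeQCDFlow.Exactness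

open MeasureTheory ProbabilityTheory Function Finset Filter
open scoped _root_.ENNReal unitInterval Topology
open Summit.Ventures.LatticeQCDFlow.Scoring

variable {Ω : Type*} [MeasurableSpace Ω] {lam : Measure Ω} [IsProbabilityMeasure lam] {g p : Ω → ℝ} {ε P : ℝ}

/-! ## §1 The defensive weight is bounded pointwise -/

omit [MeasurableSpace Ω] in
/-- `g_ε = (1 − ε)g + ε > 0` for `g ≥ 0`, `0 < ε ≤ 1`. [ours, bookkeeping] -/
theorem defensiveDensity_pos (hg0 : ∀ y, 0 ≤ g y) (hε : 0 < ε) (hε1 : ε ≤ 1) (y : Ω) : 0 < (1 - ε) * g y + ε := by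
  have : 0 ≤ (1 - ε) * g y := mul_nonneg (by linarith) (hg0 y)
  linarith

omit [MeasurableSpace Ω] in
/-- **`0 < w_ε = p/g_ε ≤ P/ε` POINTWISE** for `0 < p ≤ P`, `g ≥ 0`, `0 < ε ≤ 1`. [ours] -/
theorem defensiveWeight_le (hg0 : ∀ y, 0 ≤ g y) (hp0 : ∀ y, 0 < p y) (hpP : ∀ y, p y ≤ P) (hε : 0 < ε) (hε1 : ε ≤ 1) (y : Ω) :
    0 < p y / ((1 - ε) * g y + ε) ∧ p y / ((1 - ε) * g y + ε) ≤ P / ε := by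
  have hgε := defensiveDensity_pos hg0 hε hε1 y
  refine ⟨div_pos (hp0 y) hgε, ?_⟩
  have hP0 : 0 ≤ P := (hp0 y).le.trans (hpP y)
  have hεg : ε ≤ (1 - ε) * g y + ε := by have := mul_nonneg (by linarith : (0 : ℝ) ≤ 1 - ε) (hg0 y); linarith
  calc p y / ((1 - ε) * g y + ε) ≤ P / ((1 - ε) * g y + ε) := div_le_div_of_nonneg_right (hpP y) hgε.le
    _ ≤ P / ε := div_le_div_of_nonneg_left hP0 hε hεg

/-- `w_ε` is measurable. [ours, bookkeeping] -/
theorem defensiveWeight_measurable (hg : Measurable g) (hp : Measurable p) (ε : ℝ) :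
    Measurable fun y => p y / ((1 - ε) * g y + ε) :=
  hp.div ((hg.const_mul _).add_const _)

omit [MeasurableSpace Ω] in
/-- **Both weight tails vanish at the level `M ≥ P/ε`**: `{y | M < w_ε y} = ∅`. [ours] -/
theorem setOf_lt_defensiveWeight_eq_empty (hg0 : ∀ y, 0 ≤ g y) (hp0 : ∀ y, 0 < p y) (hpP : ∀ y, p y ≤ P) (hε : 0 < ε) (hε1 : ε ≤ 1)
    {M : ℝ} (hM : P / ε ≤ M) : {y | M < p y / ((1 - ε) * g y + ε)} = ∅ :=
  Set.eq_empty_of_forall_notMem fun y hy => absurd (lt_of_le_of_lt hM hy) (not_lt.2 (defensiveWeight_le hg0 hp0 hpP hε hε1 y).2)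

/-! ## §2 The defensive proposal is a probability law and the sampler targets `π` exactly -/

/-- `∫ g_ε dλ = 1` (`ℝ≥0∞` form) when `g·λ` is a probability law. [ours, bookkeeping] -/
theorem lintegral_defensiveDensity (hg : Measurable g) (hg0 : ∀ y, 0 ≤ g y)
    [IsProbabilityMeasure (lam.withDensity fun y => ENNReal.ofReal (g y))] (hε : 0 < ε) (hε1 : ε ≤ 1) :
    ∫⁻ y, ENNReal.ofReal ((1 - ε) * g y + ε) ∂lam = 1 := by
  have h1 : ∫⁻ y, ENNReal.ofReal (g y) ∂lam = 1 := by
    have := (measure_univ : (lam.withDensity fun y => ENNReal.ofReal (g y)) Set.univ = 1)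
    rwa [withDensity_apply _ MeasurableSet.univ, Measure.restrict_univ] at this
  have hpt : ∀ y, ENNReal.ofReal ((1 - ε) * g y + ε) = ENNReal.ofReal (1 - ε) * ENNReal.ofReal (g y) + ENNReal.ofReal ε := fun y => by
    rw [ENNReal.ofReal_add (mul_nonneg (by linarith) (hg0 y)) hε.le, ENNReal.ofReal_mul (by linarith)]
  simp_rw [hpt]
  rw [lintegral_add_right _ measurable_const, lintegral_const_mul _ hg.ennreal_ofReal, h1, lintegral_const, measure_univ, mul_one, mul_one,
    ← ENNReal.ofReal_add (by linarith) hε.le]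
  simp

/-- **`q_ε = g_ε·λ` is a probability law.** [ours] -/
theorem isProbabilityMeasure_defensive (hg : Measurable g) (hg0 : ∀ y, 0 ≤ g y)
    [IsProbabilityMeasure (lam.withDensity fun y => ENNReal.ofReal (g y))] (hε : 0 < ε) (hε1 : ε ≤ 1) :
    IsProbabilityMeasure (lam.withDensity fun y => ENNReal.ofReal ((1 - ε) * g y + ε)) :=
  ⟨by rw [withDensity_apply _ MeasurableSet.univ, Measure.restrict_univ, lintegral_defensiveDensity hg hg0 hε hε1]⟩

omit [IsProbabilityMeasure lam] in
/-- **THE SAMPLER WITH PROPOSAL `q_ε` AND WEIGHT `w_ε` TARGETS `π = p·λ` EXACTLY**: `w_ε·q_ε = p·λ`. [ours] -/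
theorem defensive_target_eq (hg : Measurable g) (hg0 : ∀ y, 0 ≤ g y) (hp : Measurable p) (hε : 0 < ε) (hε1 : ε ≤ 1) :
    (lam.withDensity fun y => ENNReal.ofReal ((1 - ε) * g y + ε)).withDensity
        (fun y => ENNReal.ofReal (p y / ((1 - ε) * g y + ε))) =
      lam.withDensity fun y => ENNReal.ofReal (p y) := by
  rw [← withDensity_mul _ ((hg.const_mul _).add_const _).ennreal_ofReal (defensiveWeight_measurable hg hp ε).ennreal_ofReal]
  congr 1
  funext y
  have hgε := defensiveDensity_pos hg0 hε hε1 y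
  simp only [Pi.mul_apply]
  rw [← ENNReal.ofReal_mul hgε.le, mul_div_cancel₀ _ hgε.ne']

omit [IsProbabilityMeasure lam] in
/-- `π = w_ε·q_ε` is a probability law when `p·λ` is. [ours, bookkeeping] -/
theorem isProbabilityMeasure_defensive_target (hg : Measurable g) (hg0 : ∀ y, 0 ≤ g y) (hp : Measurable p)
    [IsProbabilityMeasure (lam.withDensity fun y => ENNReal.ofReal (p y))] (hε : 0 < ε) (hε1 : ε ≤ 1) :
    IsProbabilityMeasure ((lam.withDensity fun y => ENNReal.ofReal ((1 - ε) * g y + ε)).withDensity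
        (fun y => ENNReal.ofReal (p y / ((1 - ε) * g y + ε)))) := by
  rw [defensive_target_eq hg hg0 hp hε hε1]; infer_instance

/-! ## §3 The mean min-one weight without an oracle -/

/-- **`c₁ ≥ 1/max(1, M)` for a weight bounded by `M` pointwise**: `∫⁻ min(1, w) dq ≥ (max 1 M)⁻¹` whenever `0 < w ≤ M` and `w·q` is a
probability law (`min(1, w) ≥ w/max(1, M)`). [ours] -/
theorem lintegral_min_one_ge_of_weight_le {q : Measure Ω} {w : Ω → ℝ} (hw : Measurable w) (hw0 : ∀ y, 0 < w y) {M : ℝ}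
    (hwM : ∀ y, w y ≤ M) [IsProbabilityMeasure (q.withDensity fun y => ENNReal.ofReal (w y))] :
    ENNReal.ofReal (max 1 M)⁻¹ ≤ ∫⁻ y, ENNReal.ofReal (min 1 (w y)) ∂q := by
  have hM1 : 1 ≤ max 1 M := le_max_left _ _
  have hM0 : 0 < max 1 M := by positivity
  have h1 : ∫⁻ y, ENNReal.ofReal (w y) ∂q = 1 := by
    have := (measure_univ : (q.withDensity fun y => ENNReal.ofReal (w y)) Set.univ = 1)
    rwa [withDensity_apply _ MeasurableSet.univ, Measure.restrict_univ] at this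
  have hpt : ∀ y, ENNReal.ofReal (max 1 M)⁻¹ * ENNReal.ofReal (w y) ≤ ENNReal.ofReal (min 1 (w y)) := by
    intro y
    rw [← ENNReal.ofReal_mul (inv_nonneg.2 hM0.le)]
    refine ENNReal.ofReal_le_ofReal (le_min ?_ ?_)
    · rw [inv_mul_le_iff₀ hM0, mul_one]; exact (hwM y).trans (le_max_right _ _)
    · calc (max 1 M)⁻¹ * w y ≤ 1 * w y := mul_le_mul_of_nonneg_right (inv_le_one_of_one_le₀ hM1) (hw0 y).le
        _ = w y := one_mul _
  calc ENNReal.ofReal (max 1 M)⁻¹ = ENNReal.ofReal (max 1 M)⁻¹ * ∫⁻ y, ENNReal.ofReal (w y) ∂q := by rw [h1, mul_one]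
    _ = ∫⁻ y, ENNReal.ofReal (max 1 M)⁻¹ * ENNReal.ofReal (w y) ∂q := (lintegral_const_mul _ hw.ennreal_ofReal).symm
    _ ≤ ∫⁻ y, ENNReal.ofReal (min 1 (w y)) ∂q := lintegral_mono hpt

/-! ## §4 The certificate with no oracle input beyond `P` -/

section Replicas

variable {Ω' : Type*} {mΩ' : MeasurableSpace Ω'} {μ : Measure Ω'} [IsProbabilityMeasure μ]
  {Z : ℕ → Ω' → (ℕ → Ω × Ω)} {q : Measure Ω} [IsProbabilityMeasure q] {w : Ω → ℝ}

/-- **THE EVERY-WEIGHT BERNSTEIN BAR FOR A POINTWISE-BOUNDED WEIGHT, NO ORACLE INPUT**: standard Borel `Ω`; `0 < w ≤ Mw` pointwise (the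
defensive weight `w_ε = p/g_ε` with `Mw = P/ε` by §1, its proposal `q_ε` and target by §2); from ANY `x`, `R ≥ 1` independent coupled pairs,
window `N`, burn-in `k`, `σ² ≥ Var_{δ_xK^k} f > 0`, `ε' ≥ 0`, `M⋆ = max(1, Mw)`:
`P(|H̄_R − π f| ≥ ε' + (c − a)(1 − M⋆⁻¹/M⋆)^k) ≤ 2·exp(−Rε'²/(2(σ² + (c − a)ε'/3))) + R·(1 − M⋆⁻¹/M⋆)^k`. [ours] -/
theorem crnLag_replicas_burnIn_bernstein_abs_target_defensive [StandardBorelSpace Ω] [Nonempty Ω] [MeasurableSingletonClass Ω]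
    [MeasurableEq Ω] [Fact (Measurable w)] (hw0 : ∀ y, 0 < w y) {Mw : ℝ} (hwM : ∀ y, w y ≤ Mw)
    [IsProbabilityMeasure (q.withDensity fun y => ENNReal.ofReal (w y))]
    (Khat : Kernel (Ω × Ω) (Ω × Ω)) [IsMarkovKernel Khat]
    (hK : ∀ z : Ω × Ω, Khat z = (q.prod (volume : Measure unitInterval)).map (fun p : Ω × unitInterval =>
      ((if (p.2 : ℝ) * w z.1 ≤ w p.1 then p.1 else z.1), (if (p.2 : ℝ) * w z.2 ≤ w p.1 then p.1 else z.2))))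
    (x : Ω) (ν : Measure (Ω × Ω)) [IsProbabilityMeasure ν]
    (hν : ν = (indepMH q w x).map fun y : Ω => (y, x)) {f : Ω → ℝ} (hf : Measurable f) {a c : ℝ} (ha : ∀ y, a ≤ f y)
    (hc : ∀ y, f y ≤ c) (k N : ℕ) (hZm : ∀ j, Measurable (Z j))
    (hlaw : ∀ j, μ.map (Z j) = Kernel.trajMeasure (X := fun _ : ℕ => Ω × Ω) ν
      (fun n : ℕ => Khat.comap (fun h : (i : ↥(Finset.Iic n)) → Ω × Ω => h ⟨n, Finset.mem_Iic.2 le_rfl⟩)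
        (measurable_pi_apply _)))
    (hind : iIndepFun Z μ) {σ2 : ℝ} (hσ : 0 < σ2)
    (hσk : variance f ((fun m : Measure Ω => m.bind (indepMH q w))^[k] (Measure.dirac x)) ≤ σ2)
    {ε' : ℝ} (hε : 0 ≤ ε') {R : ℕ} (hR : 1 ≤ R) :
    μ.real {ω | ε' + (c - a) * ((0 : ℝ≥0∞) + (1 - ENNReal.ofReal (max 1 Mw)⁻¹ / ENNReal.ofReal (max 1 Mw)) ^ k).toReal ≤
        |(R : ℝ)⁻¹ * ∑ j ∈ range R, (f ((Z j ω k).2) + ∑ n ∈ range N, (f ((Z j ω (k + n)).1) - f ((Z j ω (k + n)).2))) -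
          ∫ y, f y ∂(q.withDensity fun y => ENNReal.ofReal (w y))|} ≤
      2 * Real.exp (-(R * ε' ^ 2) / (2 * (σ2 + (c - a) * ε' / 3))) +
        R * ((0 : ℝ≥0∞) + (1 - ENNReal.ofReal (max 1 Mw)⁻¹ / ENNReal.ofReal (max 1 Mw)) ^ k).toReal := by
  have hw : Measurable w := Fact.out
  have hempty : {y | Mw < w y} = ∅ := Set.eq_empty_of_forall_notMem fun y hy => absurd hy (not_lt.2 (hwM y))
  have htq : q {y | Mw < w y} ≤ 0 := by rw [hempty, measure_empty]
  have htπ : (q.withDensity fun y => ENNReal.ofReal (w y)) {y | Mw < w y} ≤ 0 := by rw [hempty, measure_empty]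
  have h := crnLag_replicas_burnIn_bernstein_abs_target_of_inputs hw0 Khat hK x (hwM x) ν hν hf ha hc k N hZm hlaw hind hσ hσk hε hR
    (lintegral_min_one_ge_of_weight_le (q := q) hw hw0 hwM) htq ENNReal.zero_ne_top htπ ENNReal.zero_ne_top
  exact h

end Replicas

end Summit.Ventures.LatticeQCDFlow.Exactness
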